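import Literature.Analysis.FluidPDE.JetDerivativeEstimates
import HarnessLib

/-!
# The intermittent-jet perturbation: the `L¹` size of the new stress (BV §7.6, assembly)

Analysis/FluidPDE support file (everything proved): the `L¹(𝕋³)` bound, at a fixed time, of the
new Reynolds stress `perturbedStressV ν v w' ζ (S₁ Rc) f` of the jet step (`JetStressAlgebra`,
`NSRPerturbationVisc`), assembled from `norm_perturbedStressV_le`:
`∫‖R_new‖ ≤ 2∫‖S₁‖ + 4 sup‖v‖ ∫‖w‖ + 4ν ∑ᵢ∫‖∂ᵢw'‖ + ∫‖ℛ f‖`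
(Buckmaster–Vicol, EMS Surv. Math. Sci. 6 (2019), §7.6.2–7.6.3 (7.48)–(7.57)), with
`S₁ = Rc + cross + S_osc`, `f = f₁ + f₂ + f₃ + f₄`, `∫f₁ = 0 = ∫f` (so `|f₄| ≤ ∫‖f₂‖ + ∫‖f₃‖`),
the `L¹` boundedness of `ℛ` and a separately supplied bound of `∫‖ℛ f₁‖`. The sizes of the
velocity pieces enter as hypotheses (supplied by `JetVelocityEstimates`, `JetDerivativeEstimates`).

## References

* T. Buckmaster, V. Vicol, EMS Surv. Math. Sci. 6 (2019) = arXiv:1901.09023, §7.6.2–7.6.3 (7.48)–(7.57). [`BuckmasterVicol2020`]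
-/

noncomputable section

open MeasureTheory Set Filter Topology Function
open scoped InnerProductSpace ContDiff ENNReal NNReal

namespace Literature.Analysis.FluidPDE

namespace JetStep

open Literature.Analysis.FunctionSpaces FunctionSpaces.Torus Mikado NashGeometric Jet

local notation "𝕋³" => UnitAddTorus (Fin 3)
local notation "E³" => EuclideanSpace ℝ (Fin 3)
local notation "Idx" => Index (Fin 3)

/-! ## Tools -/

/-- `‖(u ⊗ v)(y) eⱼ‖ ≤ ‖u(y)‖‖v(y)‖` and `‖(u ⊗ v)(y)‖ ≤ ‖u(y)‖‖v(y)‖`. [folklore] -/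
theorem norm_tensorProd_le (u v : 𝕋³ → E³) (y : 𝕋³) : ‖Torus.tensorProd u v y‖ ≤ ‖u y‖ * ‖v y‖ := by
  refine (pi_norm_le_iff_of_nonneg (by positivity)).2 fun j => ?_
  show ‖v y j • u y‖ ≤ _
  rw [norm_smul, mul_comm]
  exact mul_le_mul_of_nonneg_left (by rw [Real.norm_eq_abs, ← Real.norm_eq_abs]; exact PiLp.norm_apply_le (v y) j) (norm_nonneg _)

/-- From `‖f‖_{L²} ≤ M` to `∫‖f‖² ≤ M²`. [folklore] -/
theorem integral_norm_sq_le_of_eLpNorm_two_le {F : Type*} [NormedAddCommGroup F] {f : 𝕋³ → F} (hf : Continuous f) {M : ℝ}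
    (hM : 0 ≤ M) (h : eLpNorm f 2 volume ≤ ENNReal.ofReal M) : ∫ y, ‖f y‖ ^ 2 ≤ M ^ 2 := by
  obtain ⟨C, hC⟩ := isCompact_univ.exists_bound_of_continuousOn hf.continuousOn
  have hmem : MemLp f 2 volume :=
    (memLp_top_of_bound hf.aestronglyMeasurable C (Eventually.of_forall fun y => hC y (mem_univ _))).mono_exponent le_top
  have e := hmem.eLpNorm_eq_integral_rpow_norm (by norm_num) (by norm_num)
  simp only [ENNReal.toReal_ofNat, Real.rpow_two] at e
  rw [e] at h
  have hI0 : 0 ≤ ∫ y, ‖f y‖ ^ 2 := integral_nonneg_of_ae (Eventually.of_forall fun y => by positivity)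
  have h2 := (ENNReal.ofReal_le_ofReal_iff hM).1 h
  have h3 : ((∫ y, ‖f y‖ ^ 2) ^ ((2 : ℝ)⁻¹)) ^ (2 : ℝ) ≤ M ^ (2 : ℝ) := Real.rpow_le_rpow (by positivity) h2 (by norm_num)
  rw [← Real.rpow_mul hI0, show (2 : ℝ)⁻¹ * 2 = 1 by norm_num, Real.rpow_one, Real.rpow_two] at h3
  exact h3

/-- `∫ ‖ℛ g‖ ≤ C ∫‖g‖` from the `L¹` operator bound. [folklore] -/
theorem integral_norm_antidivergence_le {C₁ : ℝ≥0}
    (hC₁ : ∀ g : 𝕋³ → E³, Torus.IsSmooth g → eLpNorm (Torus.antidivergence g) 1 volume ≤ C₁ * eLpNorm g 1 volume)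
    {g : 𝕋³ → E³} (hg : Torus.IsSmooth g) : ∫ y, ‖Torus.antidivergence g y‖ ≤ (C₁ : ℝ) * ∫ y, ‖g y‖ := by
  have hA : Torus.IsSmooth (Torus.antidivergence g) := Torus.isSmooth_antidivergence hg
  have e1 : eLpNorm g 1 volume = ENNReal.ofReal (∫ y, ‖g y‖) := by
    rw [eLpNorm_one_eq_lintegral_enorm, ofReal_integral_norm_eq_lintegral_enorm hg.continuous.integrable_unitAddTorus]
  have h := hC₁ g hg
  rw [e1, ← ENNReal.ofReal_coe_nnreal, ← ENNReal.ofReal_mul C₁.coe_nonneg] at h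
  exact integral_norm_le_of_eLpNorm_one_le hA.continuous (by positivity) h

namespace Datum

variable {D : Datum} (h : D.Valid)
include h

/-! ## The means: `∫f₁ = 0`, `∫f = 0`, hence `‖f₄‖ ≤ ∫‖f₂‖ + ∫‖f₃‖` -/

/-- `∫ f₁ = 0`. [folklore] -/
theorem integral_f₁ {t : ℝ} (ht : t ∈ Icc 0 D.T) : ∫ y, D.f₁ t y = 0 :=
  Torus.integral_timeDerivWithin_eq_zero (smooth_wpc h) (convex (D := D)) (uniqueDiffOn h) (fun _ hs => integral_wpc h hs) ht

/-- `∫ f = 0` (integrate the identity (⋆)). [folklore] -/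
theorem integral_ffun {Rc : ℝ → 𝕋³ → Fin 3 → E³} (hRc : Torus.IsSmoothSpaceTimeOn (Icc 0 D.T) Rc) {t : ℝ} (ht : t ∈ Icc 0 D.T) :
    ∫ y, D.ffun t y = 0 := by
  have hU := uniqueDiffOn h
  have e : ∀ y, D.ffun t y = Torus.timeDerivWithin (Icc 0 D.T) D.w t y + Torus.tensorDivergence (Torus.tensorProd (D.w t) (D.w t)) y +
      Torus.tensorDivergence (fun z j => Rc t z j + Torus.traceless (D.M t) z j) y - Torus.tensorDivergence (D.S₁ Rc t) y -
      Torus.gradient (D.qfun t) y := fun y => by rw [star h hRc ht y]; abel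
  have hwt : Torus.IsSmooth (D.w t) := (smooth_w h).isSmooth_slice ht
  have hdw : Torus.IsSmooth (Torus.timeDerivWithin (Icc 0 D.T) D.w t) := (smooth_w h).isSmooth_timeDerivWithin hU ht
  have hT1 : Torus.IsSmooth (Torus.tensorProd (D.w t) (D.w t)) := hwt.tensorProd hwt
  have hT2 : Torus.IsSmooth (fun z j => Rc t z j + Torus.traceless (D.M t) z j) :=
    (hRc.isSmooth_slice ht).add (h.hM.isSmooth_slice ht).traceless
  have hT3 : Torus.IsSmooth (D.S₁ Rc t) := (smooth_S₁ h hRc).isSmooth_slice ht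
  have hq : Torus.IsSmooth (D.qfun t) := (smooth_qfun h).isSmooth_slice ht
  have i0 : Integrable (Torus.timeDerivWithin (Icc 0 D.T) D.w t) volume := hdw.integrable
  have i1 : Integrable (fun y => Torus.tensorDivergence (Torus.tensorProd (D.w t) (D.w t)) y) volume := hT1.tensorDivergence.integrable
  have i2 : Integrable (fun y => Torus.tensorDivergence (fun z j => Rc t z j + Torus.traceless (D.M t) z j) y) volume := hT2.tensorDivergence.integrable
  have i3 : Integrable (fun y => Torus.tensorDivergence (D.S₁ Rc t) y) volume := hT3.tensorDivergence.integrable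
  have i4 : Integrable (Torus.gradient (D.qfun t)) volume := hq.gradient.integrable
  have i01 : Integrable (fun y => Torus.timeDerivWithin (Icc 0 D.T) D.w t y + Torus.tensorDivergence (Torus.tensorProd (D.w t) (D.w t)) y) volume := i0.add i1
  have i012 : Integrable (fun y => Torus.timeDerivWithin (Icc 0 D.T) D.w t y + Torus.tensorDivergence (Torus.tensorProd (D.w t) (D.w t)) y +
      Torus.tensorDivergence (fun z j => Rc t z j + Torus.traceless (D.M t) z j) y) volume := i01.add i2
  have i0123 : Integrable (fun y => Torus.timeDerivWithin (Icc 0 D.T) D.w t y + Torus.tensorDivergence (Torus.tensorProd (D.w t) (D.w t)) y +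
      Torus.tensorDivergence (fun z j => Rc t z j + Torus.traceless (D.M t) z j) y - Torus.tensorDivergence (D.S₁ Rc t) y) volume := i012.sub i3
  rw [integral_congr_ae (Eventually.of_forall e), integral_sub i0123 i4, integral_sub i012 i3, integral_add i01 i2, integral_add i0 i1,
    Torus.integral_timeDerivWithin_eq_zero (smooth_w h) (convex (D := D)) hU (fun s hs => hasZeroMean_w h hs) ht,
    Torus.integral_tensorDivergence_eq_zero' hT1, Torus.integral_tensorDivergence_eq_zero' hT2, Torus.integral_tensorDivergence_eq_zero' hT3,
    Torus.integral_gradient_eq_zero hq]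
  simp

/-- **`‖f₄‖ ≤ ∫‖f₂‖ + ∫‖f₃‖`**. [folklore] -/
theorem norm_f₄_le {Rc : ℝ → 𝕋³ → Fin 3 → E³} (hRc : Torus.IsSmoothSpaceTimeOn (Icc 0 D.T) Rc) {t : ℝ} (ht : t ∈ Icc 0 D.T) :
    ‖D.f₄ t‖ ≤ (∫ y, ‖D.f₂ t y‖) + ∫ y, ‖D.f₃ t y‖ := by
  have h0 := integral_ffun h hRc ht
  have i1 : Integrable (D.f₁ t) volume := ((smooth_f₁ h).isSmooth_slice ht).integrable
  have i2 : Integrable (D.f₂ t) volume := ((smooth_f₂ h).isSmooth_slice ht).integrable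
  have i3 : Integrable (D.f₃ t) volume := ((smooth_f₃ h).isSmooth_slice ht).integrable
  have i12 : Integrable (fun y => D.f₁ t y + D.f₂ t y) volume := i1.add i2
  have i123 : Integrable (fun y => D.f₁ t y + D.f₂ t y + D.f₃ t y) volume := i12.add i3
  have e : ∀ y, D.ffun t y = D.f₁ t y + D.f₂ t y + D.f₃ t y + D.f₄ t := fun y => rfl
  rw [integral_congr_ae (Eventually.of_forall e), integral_add i123 (integrable_const _), integral_add i12 i3,
    integral_add i1 i2, integral_f₁ h ht, zero_add, MeasureTheory.integral_const, probReal_univ, one_smul] at h0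
  have e4 : D.f₄ t = -((∫ y, D.f₂ t y) + ∫ y, D.f₃ t y) := by
    have := h0; rw [add_comm] at this; exact eq_neg_of_add_eq_zero_left this
  rw [e4, norm_neg]
  exact (norm_add_le _ _).trans (add_le_add (norm_integral_le_integral_norm _) (norm_integral_le_integral_norm _))

/-! ## The pieces of `S₁` and of `f` -/

/-- **`∫‖cross‖ ≤ 2√(E_p E_r) + E_r`** with `E_p ≥ ∫‖wp‖²`, `E_r ≥ ∫‖wr‖²`. [cite: BuckmasterVicol2020, §7.6.3 (7.54)] -/
theorem integral_norm_cross_le {t : ℝ} (ht : t ∈ Icc 0 D.T) {Ep Er : ℝ} (hEp : ∫ y, ‖D.wp t y‖ ^ 2 ≤ Ep) (hEr : ∫ y, ‖D.wr t y‖ ^ 2 ≤ Er) :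
    ∫ y, ‖D.cross t y‖ ≤ 2 * (Real.sqrt Ep * Real.sqrt Er) + Er := by
  have hwp := isSmooth_wp h ht
  have hwr : Torus.IsSmooth (D.wr t) := (smooth_wr h).isSmooth_slice ht
  have hpt : ∀ y, ‖D.cross t y‖ ≤ 2 * (‖D.wp t y‖ * ‖D.wr t y‖) + ‖D.wr t y‖ * ‖D.wr t y‖ := by
    intro y
    have e : D.cross t y = Torus.tensorProd (D.wp t) (D.wr t) y + Torus.tensorProd (D.wr t) (D.wp t) y + Torus.tensorProd (D.wr t) (D.wr t) y := by
      funext j; rfl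
    rw [e]
    calc _ ≤ ‖Torus.tensorProd (D.wp t) (D.wr t) y‖ + ‖Torus.tensorProd (D.wr t) (D.wp t) y‖ + ‖Torus.tensorProd (D.wr t) (D.wr t) y‖ :=
          (norm_add_le _ _).trans (add_le_add (norm_add_le _ _) le_rfl)
      _ ≤ ‖D.wp t y‖ * ‖D.wr t y‖ + ‖D.wr t y‖ * ‖D.wp t y‖ + ‖D.wr t y‖ * ‖D.wr t y‖ :=
          add_le_add (add_le_add (norm_tensorProd_le _ _ y) (norm_tensorProd_le _ _ y)) (norm_tensorProd_le _ _ y)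
      _ = _ := by ring
  have c1 : Continuous fun y => ‖D.wp t y‖ * ‖D.wr t y‖ := hwp.continuous.norm.mul hwr.continuous.norm
  have c2 : Continuous fun y => ‖D.wr t y‖ * ‖D.wr t y‖ := hwr.continuous.norm.mul hwr.continuous.norm
  have i1 : Integrable (fun y => 2 * (‖D.wp t y‖ * ‖D.wr t y‖)) volume := (c1.const_mul 2).integrable_unitAddTorus
  have i2 : Integrable (fun y => ‖D.wr t y‖ * ‖D.wr t y‖) volume := c2.integrable_unitAddTorus
  have i12 : Integrable (fun y => 2 * (‖D.wp t y‖ * ‖D.wr t y‖) + ‖D.wr t y‖ * ‖D.wr t y‖) volume := i1.add i2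
  calc ∫ y, ‖D.cross t y‖ ≤ ∫ y, (2 * (‖D.wp t y‖ * ‖D.wr t y‖) + ‖D.wr t y‖ * ‖D.wr t y‖) :=
        integral_mono (isSmooth_cross h ht).continuous.norm.integrable_unitAddTorus i12 hpt
    _ = 2 * (∫ y, ‖D.wp t y‖ * ‖D.wr t y‖) + ∫ y, ‖D.wr t y‖ * ‖D.wr t y‖ := by
        rw [integral_add i1 i2, integral_const_mul]
    _ ≤ 2 * (Real.sqrt Ep * Real.sqrt Er) + Er := by
        refine add_le_add (mul_le_mul_of_nonneg_left (integral_norm_mul_norm_le hwp.continuous hwr.continuous hEp hEr) (by norm_num)) ?_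
        refine le_trans (le_of_eq (integral_congr_ae (Eventually.of_forall fun y => ?_))) hEr
        show ‖D.wr t y‖ * ‖D.wr t y‖ = ‖D.wr t y‖ ^ 2; ring

/-- **`∫‖wr‖² ≤ 3(S_c L_c + E_X + E_ζ)`** (`wr = (wpc - wp) + X + ∇ζ`; `∫‖wc‖² ≤ sup‖wc‖ ∫‖wc‖`). [folklore] -/
theorem integral_norm_wr_sq_le {t : ℝ} (ht : t ∈ Icc 0 D.T) {Sc Lc EX Eζ : ℝ} (hSc : ∀ y, ‖D.wpc t y - D.wp t y‖ ≤ Sc)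
    (hLc : ∫ y, ‖D.wpc t y - D.wp t y‖ ≤ Lc) (hEX : ∫ y, ‖D.X t y‖ ^ 2 ≤ EX) (hEζ : ∫ y, ‖Torus.gradient (D.zeta t) y‖ ^ 2 ≤ Eζ) :
    ∫ y, ‖D.wr t y‖ ^ 2 ≤ 3 * (Sc * Lc + EX + Eζ) := by
  have hwc : Torus.IsSmooth (fun y => D.wpc t y - D.wp t y) := ((smooth_wpc h).isSmooth_slice ht).sub (isSmooth_wp h ht)
  have hX : Torus.IsSmooth (D.X t) := (smooth_X h).isSmooth_slice ht
  have hζ : Torus.IsSmooth (Torus.gradient (D.zeta t)) := ((smooth_zeta h).isSmooth_slice ht).gradient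
  have e : ∀ y, D.wr t y = (D.wpc t y - D.wp t y) + D.X t y + Torus.gradient (D.zeta t) y := fun y => by
    show D.w t y - D.wp t y = _
    rw [show D.w t y = D.w' t y + Torus.gradient (D.zeta t) y from rfl, show D.w' t y = D.wpc t y + D.X t y from rfl]; abel
  have hpt : ∀ y, ‖D.wr t y‖ ^ 2 ≤ 3 * (‖D.wpc t y - D.wp t y‖ ^ 2 + ‖D.X t y‖ ^ 2 + ‖Torus.gradient (D.zeta t) y‖ ^ 2) := by
    intro y
    rw [e y]
    have h1 := norm_add_le (D.wpc t y - D.wp t y + D.X t y) (Torus.gradient (D.zeta t) y)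
    have h2 := norm_add_le (D.wpc t y - D.wp t y) (D.X t y)
    nlinarith [norm_nonneg (D.wpc t y - D.wp t y + D.X t y + Torus.gradient (D.zeta t) y), norm_nonneg (D.wpc t y - D.wp t y),
      norm_nonneg (D.X t y), norm_nonneg (Torus.gradient (D.zeta t) y),
      sq_nonneg (‖D.wpc t y - D.wp t y‖ - ‖D.X t y‖), sq_nonneg (‖D.X t y‖ - ‖Torus.gradient (D.zeta t) y‖),
      sq_nonneg (‖D.wpc t y - D.wp t y‖ - ‖Torus.gradient (D.zeta t) y‖)]
  have hSc0 : 0 ≤ Sc := (norm_nonneg _).trans (hSc (Classical.arbitrary _))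
  have hwc2 : ∫ y, ‖D.wpc t y - D.wp t y‖ ^ 2 ≤ Sc * Lc := by
    calc ∫ y, ‖D.wpc t y - D.wp t y‖ ^ 2 ≤ ∫ y, Sc * ‖D.wpc t y - D.wp t y‖ :=
          integral_mono (hwc.continuous.norm.pow 2).integrable_unitAddTorus (hwc.continuous.norm.const_mul _).integrable_unitAddTorus fun y => by
            rw [sq]; exact mul_le_mul_of_nonneg_right (hSc y) (norm_nonneg _)
      _ ≤ Sc * Lc := by rw [integral_const_mul]; exact mul_le_mul_of_nonneg_left hLc hSc0
  have c1 : Integrable (fun y => ‖D.wpc t y - D.wp t y‖ ^ 2) volume := (hwc.continuous.norm.pow 2).integrable_unitAddTorus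
  have c2 : Integrable (fun y => ‖D.X t y‖ ^ 2) volume := (hX.continuous.norm.pow 2).integrable_unitAddTorus
  have c3 : Integrable (fun y => ‖Torus.gradient (D.zeta t) y‖ ^ 2) volume := (hζ.continuous.norm.pow 2).integrable_unitAddTorus
  have c12 : Integrable (fun y => ‖D.wpc t y - D.wp t y‖ ^ 2 + ‖D.X t y‖ ^ 2) volume := c1.add c2
  have c123 : Integrable (fun y => ‖D.wpc t y - D.wp t y‖ ^ 2 + ‖D.X t y‖ ^ 2 + ‖Torus.gradient (D.zeta t) y‖ ^ 2) volume := c12.add c3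
  calc ∫ y, ‖D.wr t y‖ ^ 2 ≤ ∫ y, 3 * (‖D.wpc t y - D.wp t y‖ ^ 2 + ‖D.X t y‖ ^ 2 + ‖Torus.gradient (D.zeta t) y‖ ^ 2) :=
        integral_mono (((smooth_wr h).isSmooth_slice ht).continuous.norm.pow 2).integrable_unitAddTorus (c123.const_mul 3) hpt
    _ = 3 * ((∫ y, ‖D.wpc t y - D.wp t y‖ ^ 2) + (∫ y, ‖D.X t y‖ ^ 2) + ∫ y, ‖Torus.gradient (D.zeta t) y‖ ^ 2) := by
        rw [integral_const_mul, integral_add c12 c3, integral_add c1 c2]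
    _ ≤ 3 * (Sc * Lc + EX + Eζ) := by gcongr

/-- **`∫‖∇ζ‖² ≤ 3 Z²`** from `‖∂ᵢζ‖_{L²} ≤ Z`. [folklore] -/
theorem integral_norm_gradient_zeta_sq_le {t : ℝ} (ht : t ∈ Icc 0 D.T) {Z : ℝ} (hZ0 : 0 ≤ Z)
    (hZ : ∀ i, eLpNorm (Torus.partialDeriv i (D.zeta t)) 2 volume ≤ ENNReal.ofReal Z) :
    ∫ y, ‖Torus.gradient (D.zeta t) y‖ ^ 2 ≤ 3 * Z ^ 2 := by
  have hζ : Torus.IsSmooth (D.zeta t) := (smooth_zeta h).isSmooth_slice ht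
  have e : ∀ y, ‖Torus.gradient (D.zeta t) y‖ ^ 2 = ∑ i, Torus.partialDeriv i (D.zeta t) y ^ 2 := fun y => by
    rw [EuclideanSpace.norm_sq_eq]
    exact Finset.sum_congr rfl fun i _ => by rw [Torus.gradient_apply (hζ.isContDiff (by simp)), Real.norm_eq_abs, sq_abs]
  rw [integral_congr_ae (Eventually.of_forall e), integral_finsetSum _ fun i _ =>
    (show Integrable (fun y => Torus.partialDeriv i (D.zeta t) y ^ 2) volume from ((hζ.partialDeriv i).continuous.pow 2).integrable_unitAddTorus)]
  calc ∑ i, ∫ y, Torus.partialDeriv i (D.zeta t) y ^ 2 ≤ ∑ _i : Fin 3, Z ^ 2 := Finset.sum_le_sum fun i _ => by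
        have := integral_norm_sq_le_of_eLpNorm_two_le (hζ.partialDeriv i).continuous hZ0 (hZ i)
        simpa [Real.norm_eq_abs, sq_abs] using this
    _ = 3 * Z ^ 2 := by simp only [Finset.sum_const, Finset.card_univ, Fintype.card_fin, nsmul_eq_mul, Nat.cast_ofNat]

/-- `‖cvec_x‖ ≤ 27 H₁` and `‖∂ₗ cvec_x‖ ≤ 27 H₂`. [folklore] -/
theorem norm_cvec_le {A₀ A₁ A₂ H₁ H₂ : ℝ} (hA : D.AmpBounds A₀ A₁ A₂ H₁ H₂) (x : Idx) {t : ℝ} (ht : t ∈ Icc 0 D.T) (y : 𝕋³) (l : Fin 3) :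
    ‖D.cvec x t y‖ ≤ 27 * H₁ ∧ ‖Torus.partialDeriv l (D.cvec x t) y‖ ≤ 27 * H₂ := by
  have hh := (smooth_hsq h x).isSmooth_slice ht
  have hk := CL22.norm_dirVec_le x
  have hd : ∀ z, |dirD x (JAmp.hsq D.γ₀ D.M x t) z| ≤ 9 * H₁ := fun z => by
    unfold dirD
    calc |∑ j, ((dir x j : ℤ) : ℝ) * Torus.partialDeriv j (JAmp.hsq D.γ₀ D.M x t) z| ≤ ∑ j, |((dir x j : ℤ) : ℝ) * Torus.partialDeriv j (JAmp.hsq D.γ₀ D.M x t) z| :=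
          Finset.abs_sum_le_sum_abs _ _
      _ ≤ ∑ _j : Fin 3, 3 * H₁ := Finset.sum_le_sum fun j _ => by
          rw [abs_mul]; exact mul_le_mul (abs_dir_le x j) (hA.dh_le x t ht z j) (abs_nonneg _) (by norm_num)
      _ = 9 * H₁ := by simp only [Finset.sum_const, Finset.card_univ, Fintype.card_fin, nsmul_eq_mul, Nat.cast_ofNat]; ring
  have hdd : |Torus.partialDeriv l (fun z => dirD x (JAmp.hsq D.γ₀ D.M x t) z) y| ≤ 9 * H₂ := by
    have h1 := abs_partialDeriv_sum_mul_le (fun j => Torus.isSmooth_const ((dir x j : ℤ) : ℝ)) (fun j => hh.partialDeriv j) l y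
    refine (le_of_eq (by rfl)).trans (h1.trans ?_)
    calc ∑ j, (|Torus.partialDeriv l (fun _ : 𝕋³ => ((dir x j : ℤ) : ℝ)) y| * |Torus.partialDeriv j (JAmp.hsq D.γ₀ D.M x t) y| +
          |((dir x j : ℤ) : ℝ)| * |Torus.partialDeriv l (Torus.partialDeriv j (JAmp.hsq D.γ₀ D.M x t)) y|)
        ≤ ∑ _j : Fin 3, (0 + 3 * H₂) := Finset.sum_le_sum fun j _ => by
          rw [Torus.partialDeriv_const_apply, abs_zero, zero_mul]
          exact add_le_add le_rfl (mul_le_mul (abs_dir_le x j) (hA.ddh_le x t ht y j l) (abs_nonneg _) (by norm_num))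
      _ = 9 * H₂ := by simp only [Finset.sum_const, Finset.card_univ, Fintype.card_fin, nsmul_eq_mul, Nat.cast_ofNat]; ring
  have hH1 := hA.hH₁; have hH2 := hA.hH₂
  refine ⟨?_, ?_⟩
  · show ‖dirD x (JAmp.hsq D.γ₀ D.M x t) y • dirVec x‖ ≤ _
    rw [norm_smul, Real.norm_eq_abs]
    calc |dirD x (JAmp.hsq D.γ₀ D.M x t) y| * ‖dirVec x‖ ≤ 9 * H₁ * 3 := mul_le_mul (hd y) hk (norm_nonneg _) (by positivity)
      _ = 27 * H₁ := by ring
  · have hs : Torus.IsSmooth (fun z => dirD x (JAmp.hsq D.γ₀ D.M x t) z) :=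
      Torus.isSmooth_finset_sum _ fun j _ => by
        have : Torus.IsSmooth (fun z => ((dir x j : ℤ) : ℝ) * Torus.partialDeriv j (JAmp.hsq D.γ₀ D.M x t) z) := (Torus.isSmooth_const _).mul (hh.partialDeriv j)
        exact this
    have h1 := norm_partialDeriv_smul_le hs (Torus.isSmooth_const (dirVec x)) l y
    rw [Torus.partialDeriv_const_apply, norm_zero, mul_zero, add_zero] at h1
    refine (le_of_eq (by rfl)).trans (h1.trans ?_)
    calc |Torus.partialDeriv l (fun z => dirD x (JAmp.hsq D.γ₀ D.M x t) z) y| * ‖dirVec x‖ ≤ 9 * H₂ * 3 := mul_le_mul hdd hk (norm_nonneg _) (by positivity)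
      _ = 27 * H₂ := by ring

/-- **`∫‖S_osc‖ ≤ 162 N H₁ B σ⁻¹`** and **`∫‖f₂‖ ≤ 7·81 N H₂ B σ⁻¹`** (`∫|∂ₗΔ⁻¹(η²ψ̃²-1)| ≤ Bσ⁻¹`).
[cite: BuckmasterVicol2020, §7.6.3 (7.56)] -/
theorem integral_norm_Sosc_f₂_le {A₀ A₁ A₂ H₁ H₂ B : ℝ} (hA : D.AmpBounds A₀ A₁ A₂ H₁ H₂) (hB : ∀ x t, Jet.Bounds B (D.J x) D.s x t)
    {t : ℝ} (ht : t ∈ Icc 0 D.T) :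
    ∫ y, ‖D.Sosc t y‖ ≤ NN * (2 * (27 * H₁) * (3 * (B * (D.σ : ℝ)⁻¹))) ∧
    ∫ y, ‖D.f₂ t y‖ ≤ NN * ((2 * 3 + 1) * (27 * H₂) * (3 * (B * (D.σ : ℝ)⁻¹))) := by
  have hH1 := hA.hH₁; have hH2 := hA.hH₂
  have hΨ : ∀ x, Torus.IsSmooth (D.Psi x t) := fun x => (smooth_Psi h x).isSmooth_slice ht
  have hcv : ∀ x, Torus.IsSmooth (D.cvec x t) := fun x => (smooth_cvec h x).isSmooth_slice ht
  have hSΨ : ∀ x, Continuous fun y => ∑ l, |Torus.partialDeriv l (D.Psi x t) y| := fun x =>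
    continuous_finsetSum _ fun l _ => ((hΨ x).partialDeriv l).continuous.abs
  have hIΨ : ∀ x, ∫ y, ∑ l, |Torus.partialDeriv l (D.Psi x t) y| ≤ 3 * (B * (D.σ : ℝ)⁻¹) := fun x => by
    rw [integral_finsetSum _ fun l _ => ((hΨ x).partialDeriv l).continuous.abs.integrable_unitAddTorus]
    calc ∑ l, ∫ y, |Torus.partialDeriv l (D.Psi x t) y| ≤ ∑ _l : Fin 3, B * (D.σ : ℝ)⁻¹ := Finset.sum_le_sum fun l _ => (hB x t).int_grad_invLap_fastF l
      _ = 3 * (B * (D.σ : ℝ)⁻¹) := by simp only [Finset.sum_const, Finset.card_univ, Fintype.card_fin, nsmul_eq_mul, Nat.cast_ofNat]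
  refine ⟨?_, ?_⟩
  · have hpt : ∀ y, ‖D.Sosc t y‖ ≤ ∑ x, 2 * (27 * H₁) * ∑ l, |Torus.partialDeriv l (D.Psi x t) y| := by
      intro y
      refine (pi_norm_le_iff_of_nonneg (Finset.sum_nonneg fun x _ => mul_nonneg (by positivity) (Finset.sum_nonneg fun l _ => abs_nonneg _))).2 fun j => ?_
      show ‖∑ x, Torus.expansionTensor (D.cvec x t) (D.Psi x t) y j‖ ≤ _
      refine (norm_sum_le _ _).trans (Finset.sum_le_sum fun x _ => ?_)
      refine (CL22.norm_expansionTensor_apply_le ((hΨ x).isContDiff (by simp)) y j).trans ?_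
      exact mul_le_mul_of_nonneg_right (mul_le_mul_of_nonneg_left (norm_cvec_le h hA x ht y 0).1 (by norm_num)) (Finset.sum_nonneg fun _ _ => abs_nonneg _)
    calc ∫ y, ‖D.Sosc t y‖ ≤ ∫ y, ∑ x, 2 * (27 * H₁) * ∑ l, |Torus.partialDeriv l (D.Psi x t) y| :=
          integral_mono (isSmooth_Sosc h ht).continuous.norm.integrable_unitAddTorus
            ((continuous_finsetSum _ fun x _ => (hSΨ x).const_mul _).integrable_unitAddTorus) hpt
      _ = ∑ x, 2 * (27 * H₁) * ∫ y, ∑ l, |Torus.partialDeriv l (D.Psi x t) y| := by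
          rw [integral_finsetSum _ fun x _ => ((hSΨ x).const_mul _).integrable_unitAddTorus]
          exact Finset.sum_congr rfl fun x _ => integral_const_mul _ _
      _ ≤ _ := sum_le_NN_mul fun x => mul_le_mul_of_nonneg_left (hIΨ x) (by positivity)
  · have hpt : ∀ y, ‖D.f₂ t y‖ ≤ ∑ x, (2 * 3 + 1) * (27 * H₂) * ∑ l, |Torus.partialDeriv l (D.Psi x t) y| := by
      intro y
      show ‖-∑ x, Torus.expansionRemainder (D.cvec x t) (D.Psi x t) y‖ ≤ _
      rw [norm_neg]
      refine (norm_sum_le _ _).trans (Finset.sum_le_sum fun x _ => ?_)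
      have := CL22.norm_expansionRemainder_le (hcv x) ((hΨ x).isContDiff (by simp)) y (by positivity : (0:ℝ) ≤ 27 * H₂)
        (fun l => (norm_cvec_le h hA x ht y l).2)
      simpa [Fintype.card_fin] using this
    calc ∫ y, ‖D.f₂ t y‖ ≤ ∫ y, ∑ x, (2 * 3 + 1) * (27 * H₂) * ∑ l, |Torus.partialDeriv l (D.Psi x t) y| :=
          integral_mono ((smooth_f₂ h).isSmooth_slice ht).continuous.norm.integrable_unitAddTorus
            ((continuous_finsetSum _ fun x _ => (hSΨ x).const_mul _).integrable_unitAddTorus) hpt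
      _ = ∑ x, (2 * 3 + 1) * (27 * H₂) * ∫ y, ∑ l, |Torus.partialDeriv l (D.Psi x t) y| := by
          rw [integral_finsetSum _ fun x _ => ((hSΨ x).const_mul _).integrable_unitAddTorus]
          exact Finset.sum_congr rfl fun x _ => integral_const_mul _ _
      _ ≤ _ := sum_le_NN_mul fun x => mul_le_mul_of_nonneg_left (hIΨ x) (by positivity)

/-- **`∫‖f₃‖ ≤ 3 N μ′⁻¹ H₁`** (`∫η²ψ̃² = 1`). [cite: BuckmasterVicol2020, §7.6.3 (7.57)] -/
theorem integral_norm_f₃_le {A₀ A₁ A₂ H₁ H₂ : ℝ} (hA : D.AmpBounds A₀ A₁ A₂ H₁ H₂) {t : ℝ} (ht : t ∈ Icc 0 D.T) :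
    ∫ y, ‖D.f₃ t y‖ ≤ NN * (3 * D.mup⁻¹ * H₁) := by
  have hmup := (pos h).2.2.2.1
  have hH1 := hA.hH₁
  have hf : ∀ x, Continuous (Jet.fastF (D.J x) D.s x t) := fun x => ((smooth_fastF h x).isSmooth_slice ht).continuous
  have hf0 : ∀ x y, 0 ≤ Jet.fastF (D.J x) D.s x t y := fun x y => by unfold Jet.fastF; positivity
  have hpt : ∀ y, ‖D.f₃ t y‖ ≤ ∑ x, 3 * D.mup⁻¹ * H₁ * Jet.fastF (D.J x) D.s x t y := by
    intro y
    show ‖-∑ x, (D.mup⁻¹ * (D.hdot x t y * Jet.fastF (D.J x) D.s x t y)) • dirVec x‖ ≤ _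
    rw [norm_neg]
    refine (norm_sum_le _ _).trans (Finset.sum_le_sum fun x _ => ?_)
    rw [norm_smul, Real.norm_eq_abs, abs_mul, abs_of_pos (inv_pos.2 hmup), abs_mul, abs_of_nonneg (hf0 x y)]
    calc D.mup⁻¹ * (|D.hdot x t y| * Jet.fastF (D.J x) D.s x t y) * ‖dirVec x‖ ≤ D.mup⁻¹ * (H₁ * Jet.fastF (D.J x) D.s x t y) * 3 := by
          refine mul_le_mul (mul_le_mul_of_nonneg_left (mul_le_mul_of_nonneg_right (hA.dth_le x t ht y) (hf0 x y)) (by positivity))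
            (CL22.norm_dirVec_le x) (norm_nonneg _) (mul_nonneg (by positivity) (mul_nonneg hH1 (hf0 x y)))
      _ = _ := by ring
  calc ∫ y, ‖D.f₃ t y‖ ≤ ∫ y, ∑ x, 3 * D.mup⁻¹ * H₁ * Jet.fastF (D.J x) D.s x t y :=
        integral_mono ((smooth_f₃ h).isSmooth_slice ht).continuous.norm.integrable_unitAddTorus
          ((continuous_finsetSum _ fun x _ => (hf x).const_mul _).integrable_unitAddTorus) hpt
    _ = ∑ x, 3 * D.mup⁻¹ * H₁ * ∫ y, Jet.fastF (D.J x) D.s x t y := by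
        rw [integral_finsetSum _ fun x _ => ((hf x).const_mul _).integrable_unitAddTorus]
        exact Finset.sum_congr rfl fun x _ => integral_const_mul _ _
    _ ≤ _ := sum_le_NN_mul fun x => by rw [Jet.integral_fastF D.s (Jvalid h x) hd3 x t, mul_one]

/-! ## The assembly -/

/-- **The `L¹` size of the new stress at time `t`** (BV §7.6.2–7.6.3), from the sizes of the pieces.
[cite: BuckmasterVicol2020, §7.6.2 (7.48)–(7.53)] -/
theorem integral_norm_newStress_le {ν : ℝ} {v : ℝ → 𝕋³ → E³} {Rc : ℝ → 𝕋³ → Fin 3 → E³}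
    (hRc : Torus.IsSmoothSpaceTimeOn (Icc 0 D.T) Rc) {t : ℝ} (ht : t ∈ Icc 0 D.T) (hvc : Continuous (v t))
    {V₀ ρc Ep Sc Lc EX Eζ Lp LdW LdX LS Lf₂ Lf₃ Lf₁ : ℝ} {C₁ : ℝ≥0}
    (hV : ∀ y, ‖v t y‖ ≤ V₀) (hρ : ∀ y, ‖Rc t y‖ ≤ ρc)
    (hEp : ∫ y, ‖D.wp t y‖ ^ 2 ≤ Ep) (hLp : ∫ y, ‖D.wp t y‖ ≤ Lp)
    (hSc : ∀ y, ‖D.wpc t y - D.wp t y‖ ≤ Sc) (hLc : ∫ y, ‖D.wpc t y - D.wp t y‖ ≤ Lc)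
    (hEX : ∫ y, ‖D.X t y‖ ^ 2 ≤ EX) (hEζ : ∫ y, ‖Torus.gradient (D.zeta t) y‖ ^ 2 ≤ Eζ)
    (hdW : ∀ i, ∫ y, ‖Torus.partialDeriv i (D.wpc t) y‖ ≤ LdW) (hdX : ∀ i, ∫ y, ‖Torus.partialDeriv i (D.X t) y‖ ≤ LdX)
    (hS : ∫ y, ‖D.Sosc t y‖ ≤ LS) (hf₂ : ∫ y, ‖D.f₂ t y‖ ≤ Lf₂) (hf₃ : ∫ y, ‖D.f₃ t y‖ ≤ Lf₃)
    (hf₁ : ∫ y, ‖Torus.antidivergence (D.f₁ t) y‖ ≤ Lf₁)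
    (hC₁ : ∀ g : 𝕋³ → E³, Torus.IsSmooth g → eLpNorm (Torus.antidivergence g) 1 volume ≤ C₁ * eLpNorm g 1 volume) :
    ∫ y, ‖Torus.perturbedStressV ν v D.w' D.zeta (D.S₁ Rc) D.ffun t y‖ ≤
      2 * (ρc + (2 * (Real.sqrt Ep * Real.sqrt (3 * (Sc * Lc + EX + Eζ))) + 3 * (Sc * Lc + EX + Eζ)) + LS) +
      4 * V₀ * (Lp + Lc + Real.sqrt EX + Real.sqrt Eζ) + 4 * |ν| * (3 * (LdW + LdX)) +
      (Lf₁ + (C₁ : ℝ) * (2 * (Lf₂ + Lf₃))) := by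
  have hU := uniqueDiffOn h
  -- smoothness at time `t`
  have hw' : Torus.IsSmooth (D.w' t) := (smooth_w' h).isSmooth_slice ht
  have hw : Torus.IsSmooth (D.w t) := (smooth_w h).isSmooth_slice ht
  have hwpc : Torus.IsSmooth (D.wpc t) := (smooth_wpc h).isSmooth_slice ht
  have hwp := isSmooth_wp h ht
  have hX : Torus.IsSmooth (D.X t) := (smooth_X h).isSmooth_slice ht
  have hζ : Torus.IsSmooth (Torus.gradient (D.zeta t)) := ((smooth_zeta h).isSmooth_slice ht).gradient
  have hS₁ : Torus.IsSmooth (D.S₁ Rc t) := (smooth_S₁ h hRc).isSmooth_slice ht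
  have hf1 : Torus.IsSmooth (D.f₁ t) := (smooth_f₁ h).isSmooth_slice ht
  have hf2 : Torus.IsSmooth (D.f₂ t) := (smooth_f₂ h).isSmooth_slice ht
  have hf3 : Torus.IsSmooth (D.f₃ t) := (smooth_f₃ h).isSmooth_slice ht
  have hg : Torus.IsSmooth (fun y => D.f₂ t y + D.f₃ t y + D.f₄ t) := (hf2.add hf3).add (Torus.isSmooth_const _)
  have hff : Torus.IsSmooth (D.ffun t) := (smooth_ffun h).isSmooth_slice ht
  have hAf : Torus.IsSmooth (Torus.antidivergence (D.ffun t)) := Torus.isSmooth_antidivergence hff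
  -- nonnegativity of the sizes
  have hV0 : 0 ≤ V₀ := (norm_nonneg _).trans (hV (Classical.arbitrary _))
  have hSc0 : 0 ≤ Sc := (norm_nonneg _).trans (hSc (Classical.arbitrary _))
  -- the pointwise bound
  have hpt : ∀ y, ‖Torus.perturbedStressV ν v D.w' D.zeta (D.S₁ Rc) D.ffun t y‖ ≤
      2 * ‖D.S₁ Rc t y‖ + 4 * (‖v t y‖ * ‖D.w t y‖) + 4 * |ν| * ∑ i, ‖Torus.partialDeriv i (D.w' t) y‖ + ‖Torus.antidivergence (D.ffun t) y‖ := by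
    intro y
    have := Torus.norm_perturbedStressV_le (ν := ν) (u := v) (w' := D.w') (ζ := D.zeta) (S₁ := D.S₁ Rc) (f := D.ffun) (t := t)
      (hw'.isContDiff (by simp)) y
    have e1 : ‖Torus.incr D.w' D.zeta t y‖ = ‖D.w t y‖ := rfl
    rw [e1] at this
    nlinarith [this]
  -- integrate the majorant
  have cS : Continuous fun y => ‖D.S₁ Rc t y‖ := hS₁.continuous.norm
  have cvw : Continuous fun y => ‖v t y‖ * ‖D.w t y‖ := hvc.norm.mul hw.continuous.norm
  have cd : ∀ i, Continuous fun y => ‖Torus.partialDeriv i (D.w' t) y‖ := fun i => (hw'.partialDeriv i).continuous.norm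
  have csum : Continuous fun y => ∑ i, ‖Torus.partialDeriv i (D.w' t) y‖ := continuous_finsetSum _ fun i _ => cd i
  have cA : Continuous fun y => ‖Torus.antidivergence (D.ffun t) y‖ := hAf.continuous.norm
  have imaj : Integrable (fun y => 2 * ‖D.S₁ Rc t y‖ + 4 * (‖v t y‖ * ‖D.w t y‖) + 4 * |ν| * ∑ i, ‖Torus.partialDeriv i (D.w' t) y‖ +
      ‖Torus.antidivergence (D.ffun t) y‖) volume :=
    ((((cS.const_mul 2).add (cvw.const_mul 4)).add (csum.const_mul _)).add cA).integrable_unitAddTorus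
  have step1 : ∫ y, ‖Torus.perturbedStressV ν v D.w' D.zeta (D.S₁ Rc) D.ffun t y‖ ≤
      2 * (∫ y, ‖D.S₁ Rc t y‖) + 4 * (∫ y, ‖v t y‖ * ‖D.w t y‖) + 4 * |ν| * (∫ y, ∑ i, ‖Torus.partialDeriv i (D.w' t) y‖) +
      ∫ y, ‖Torus.antidivergence (D.ffun t) y‖ := by
    refine (integral_mono_of_nonneg (Eventually.of_forall fun y => norm_nonneg _) imaj (Eventually.of_forall hpt)).trans (le_of_eq ?_)
    have i1 : Integrable (fun y => 2 * ‖D.S₁ Rc t y‖) volume := (cS.const_mul 2).integrable_unitAddTorus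
    have i2 : Integrable (fun y => 4 * (‖v t y‖ * ‖D.w t y‖)) volume := (cvw.const_mul 4).integrable_unitAddTorus
    have i3 : Integrable (fun y => 4 * |ν| * ∑ i, ‖Torus.partialDeriv i (D.w' t) y‖) volume := (csum.const_mul _).integrable_unitAddTorus
    have i12 : Integrable (fun y => 2 * ‖D.S₁ Rc t y‖ + 4 * (‖v t y‖ * ‖D.w t y‖)) volume := i1.add i2
    have i123 : Integrable (fun y => 2 * ‖D.S₁ Rc t y‖ + 4 * (‖v t y‖ * ‖D.w t y‖) + 4 * |ν| * ∑ i, ‖Torus.partialDeriv i (D.w' t) y‖) volume := i12.add i3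
    rw [integral_add i123 cA.integrable_unitAddTorus, integral_add i12 i3, integral_add i1 i2,
      integral_const_mul, integral_const_mul, integral_const_mul]
  -- (i) `S₁`
  have hEr := integral_norm_wr_sq_le h ht hSc hLc hEX hEζ
  have bS : ∫ y, ‖D.S₁ Rc t y‖ ≤ ρc + (2 * (Real.sqrt Ep * Real.sqrt (3 * (Sc * Lc + EX + Eζ))) + 3 * (Sc * Lc + EX + Eζ)) + LS := by
    have hcr := integral_norm_cross_le h ht hEp hEr
    have hpt' : ∀ y, ‖D.S₁ Rc t y‖ ≤ ‖Rc t y‖ + ‖D.cross t y‖ + ‖D.Sosc t y‖ := fun y => by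
      have e : D.S₁ Rc t y = Rc t y + D.cross t y + D.Sosc t y := by funext j; rfl
      rw [e]; exact (norm_add_le _ _).trans (add_le_add (norm_add_le _ _) le_rfl)
    have cR : Continuous fun y => ‖Rc t y‖ := (hRc.isSmooth_slice ht).continuous.norm
    have cc : Continuous fun y => ‖D.cross t y‖ := (isSmooth_cross h ht).continuous.norm
    have co : Continuous fun y => ‖D.Sosc t y‖ := (isSmooth_Sosc h ht).continuous.norm
    have iRc : Integrable (fun y => ‖Rc t y‖ + ‖D.cross t y‖) volume := (cR.add cc).integrable_unitAddTorus
    have iRcS : Integrable (fun y => ‖Rc t y‖ + ‖D.cross t y‖ + ‖D.Sosc t y‖) volume := ((cR.add cc).add co).integrable_unitAddTorus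
    calc ∫ y, ‖D.S₁ Rc t y‖ ≤ ∫ y, (‖Rc t y‖ + ‖D.cross t y‖ + ‖D.Sosc t y‖) := integral_mono cS.integrable_unitAddTorus iRcS hpt'
      _ = (∫ y, ‖Rc t y‖) + (∫ y, ‖D.cross t y‖) + ∫ y, ‖D.Sosc t y‖ := by
          rw [integral_add iRc co.integrable_unitAddTorus, integral_add cR.integrable_unitAddTorus cc.integrable_unitAddTorus]
      _ ≤ ρc + (2 * (Real.sqrt Ep * Real.sqrt (3 * (Sc * Lc + EX + Eζ))) + 3 * (Sc * Lc + EX + Eζ)) + LS := by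
          refine add_le_add (add_le_add ?_ hcr) hS
          calc ∫ y, ‖Rc t y‖ ≤ ∫ _y : 𝕋³, ρc := integral_mono cR.integrable_unitAddTorus (integrable_const _) hρ
            _ = ρc := by simp
  -- (ii) the linear term
  have bL : ∫ y, ‖v t y‖ * ‖D.w t y‖ ≤ V₀ * (Lp + Lc + Real.sqrt EX + Real.sqrt Eζ) := by
    have hw4 : ∀ y, ‖D.w t y‖ ≤ ‖D.wp t y‖ + ‖D.wpc t y - D.wp t y‖ + ‖D.X t y‖ + ‖Torus.gradient (D.zeta t) y‖ := fun y => by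
      have e : D.w t y = D.wp t y + (D.wpc t y - D.wp t y) + D.X t y + Torus.gradient (D.zeta t) y := by
        rw [show D.w t y = D.w' t y + Torus.gradient (D.zeta t) y from rfl, show D.w' t y = D.wpc t y + D.X t y from rfl]; abel
      rw [e]
      exact (norm_add_le _ _).trans (add_le_add ((norm_add_le _ _).trans (add_le_add (norm_add_le _ _) le_rfl)) le_rfl)
    have c1 : Continuous fun y => ‖D.wp t y‖ := hwp.continuous.norm
    have c2 : Continuous fun y => ‖D.wpc t y - D.wp t y‖ := (hwpc.sub hwp).continuous.norm
    have c3 : Continuous fun y => ‖D.X t y‖ := hX.continuous.norm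
    have c4 : Continuous fun y => ‖Torus.gradient (D.zeta t) y‖ := hζ.continuous.norm
    have hIw : ∫ y, ‖D.w t y‖ ≤ Lp + Lc + Real.sqrt EX + Real.sqrt Eζ := by
      have j12 : Integrable (fun y => ‖D.wp t y‖ + ‖D.wpc t y - D.wp t y‖) volume := (c1.add c2).integrable_unitAddTorus
      have j123 : Integrable (fun y => ‖D.wp t y‖ + ‖D.wpc t y - D.wp t y‖ + ‖D.X t y‖) volume := ((c1.add c2).add c3).integrable_unitAddTorus
      have j1234 : Integrable (fun y => ‖D.wp t y‖ + ‖D.wpc t y - D.wp t y‖ + ‖D.X t y‖ + ‖Torus.gradient (D.zeta t) y‖) volume :=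
        (((c1.add c2).add c3).add c4).integrable_unitAddTorus
      calc ∫ y, ‖D.w t y‖ ≤ ∫ y, (‖D.wp t y‖ + ‖D.wpc t y - D.wp t y‖ + ‖D.X t y‖ + ‖Torus.gradient (D.zeta t) y‖) :=
            integral_mono hw.continuous.norm.integrable_unitAddTorus j1234 hw4
        _ = (∫ y, ‖D.wp t y‖) + (∫ y, ‖D.wpc t y - D.wp t y‖) + (∫ y, ‖D.X t y‖) + ∫ y, ‖Torus.gradient (D.zeta t) y‖ := by
            rw [integral_add j123 c4.integrable_unitAddTorus, integral_add j12 c3.integrable_unitAddTorus,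
              integral_add c1.integrable_unitAddTorus c2.integrable_unitAddTorus]
        _ ≤ Lp + Lc + Real.sqrt EX + Real.sqrt Eζ :=
            add_le_add (add_le_add (add_le_add hLp hLc) (integral_norm_le_sqrt hX.continuous hEX)) (integral_norm_le_sqrt hζ.continuous hEζ)
    calc ∫ y, ‖v t y‖ * ‖D.w t y‖ ≤ ∫ y, V₀ * ‖D.w t y‖ :=
          integral_mono cvw.integrable_unitAddTorus (hw.continuous.norm.const_mul _).integrable_unitAddTorus fun y =>
            mul_le_mul_of_nonneg_right (hV y) (norm_nonneg _)
      _ ≤ V₀ * (Lp + Lc + Real.sqrt EX + Real.sqrt Eζ) := by rw [integral_const_mul]; exact mul_le_mul_of_nonneg_left hIw hV0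
  -- (iii) the dissipative term
  have bD : ∫ y, ∑ i, ‖Torus.partialDeriv i (D.w' t) y‖ ≤ 3 * (LdW + LdX) := by
    rw [integral_finsetSum _ fun i _ => (cd i).integrable_unitAddTorus]
    calc ∑ i, ∫ y, ‖Torus.partialDeriv i (D.w' t) y‖ ≤ ∑ _i : Fin 3, (LdW + LdX) := Finset.sum_le_sum fun i _ => by
          have e : Torus.partialDeriv i (D.w' t) = fun y => Torus.partialDeriv i (D.wpc t) y + Torus.partialDeriv i (D.X t) y := by
            rw [show D.w' t = D.wpc t + D.X t from rfl, Torus.partialDeriv_add (hwpc.isContDiff (by simp)) (hX.isContDiff (by simp))]; rfl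
          rw [e]
          have c1 : Continuous fun y => ‖Torus.partialDeriv i (D.wpc t) y‖ := (hwpc.partialDeriv i).continuous.norm
          have c2 : Continuous fun y => ‖Torus.partialDeriv i (D.X t) y‖ := (hX.partialDeriv i).continuous.norm
          calc ∫ y, ‖Torus.partialDeriv i (D.wpc t) y + Torus.partialDeriv i (D.X t) y‖ ≤ ∫ y, (‖Torus.partialDeriv i (D.wpc t) y‖ + ‖Torus.partialDeriv i (D.X t) y‖) :=
                integral_mono (((hwpc.partialDeriv i).continuous.add (hX.partialDeriv i).continuous).norm.integrable_unitAddTorus)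
                  (c1.add c2).integrable_unitAddTorus fun y => norm_add_le _ _
            _ ≤ LdW + LdX := by rw [integral_add c1.integrable_unitAddTorus c2.integrable_unitAddTorus]; exact add_le_add (hdW i) (hdX i)
      _ = 3 * (LdW + LdX) := by simp only [Finset.sum_const, Finset.card_univ, Fintype.card_fin, nsmul_eq_mul, Nat.cast_ofNat]
  -- (iv) the antidivergence term
  have bA : ∫ y, ‖Torus.antidivergence (D.ffun t) y‖ ≤ Lf₁ + (C₁ : ℝ) * (2 * (Lf₂ + Lf₃)) := by
    have e : D.ffun t = (D.f₁ t) + (fun y => D.f₂ t y + D.f₃ t y + D.f₄ t) := by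
      funext y; show D.f₁ t y + D.f₂ t y + D.f₃ t y + D.f₄ t = D.f₁ t y + (D.f₂ t y + D.f₃ t y + D.f₄ t); abel
    rw [e, Torus.antidivergence_add hf1 hg]
    have cA1 : Continuous fun y => ‖Torus.antidivergence (D.f₁ t) y‖ := (Torus.isSmooth_antidivergence hf1).continuous.norm
    have cA2 : Continuous fun y => ‖Torus.antidivergence (fun y => D.f₂ t y + D.f₃ t y + D.f₄ t) y‖ := (Torus.isSmooth_antidivergence hg).continuous.norm
    have hg1 : ∫ y, ‖D.f₂ t y + D.f₃ t y + D.f₄ t‖ ≤ 2 * (Lf₂ + Lf₃) := by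
      have c2 : Continuous fun y => ‖D.f₂ t y‖ := hf2.continuous.norm
      have c3 : Continuous fun y => ‖D.f₃ t y‖ := hf3.continuous.norm
      have h4 := norm_f₄_le h hRc ht
      have k23 : Integrable (fun y => ‖D.f₂ t y‖ + ‖D.f₃ t y‖) volume := (c2.add c3).integrable_unitAddTorus
      have k234 : Integrable (fun y => ‖D.f₂ t y‖ + ‖D.f₃ t y‖ + ‖D.f₄ t‖) volume := ((c2.add c3).add continuous_const).integrable_unitAddTorus
      calc ∫ y, ‖D.f₂ t y + D.f₃ t y + D.f₄ t‖ ≤ ∫ y, (‖D.f₂ t y‖ + ‖D.f₃ t y‖ + ‖D.f₄ t‖) :=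
            integral_mono hg.continuous.norm.integrable_unitAddTorus k234 fun y => (norm_add_le _ _).trans (add_le_add (norm_add_le _ _) le_rfl)
        _ = (∫ y, ‖D.f₂ t y‖) + (∫ y, ‖D.f₃ t y‖) + ‖D.f₄ t‖ := by
            rw [integral_add k23 (integrable_const _), integral_add c2.integrable_unitAddTorus c3.integrable_unitAddTorus]; simp
        _ ≤ Lf₂ + Lf₃ + (Lf₂ + Lf₃) := add_le_add (add_le_add hf₂ hf₃) (h4.trans (add_le_add hf₂ hf₃))
        _ = 2 * (Lf₂ + Lf₃) := by ring
    calc ∫ y, ‖(Torus.antidivergence (D.f₁ t) + Torus.antidivergence (fun y => D.f₂ t y + D.f₃ t y + D.f₄ t)) y‖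
        ≤ ∫ y, (‖Torus.antidivergence (D.f₁ t) y‖ + ‖Torus.antidivergence (fun y => D.f₂ t y + D.f₃ t y + D.f₄ t) y‖) :=
          integral_mono (by rw [← Torus.antidivergence_add hf1 hg, ← e]; exact cA.integrable_unitAddTorus) (cA1.add cA2).integrable_unitAddTorus
            fun y => norm_add_le _ _
      _ ≤ Lf₁ + (C₁ : ℝ) * (2 * (Lf₂ + Lf₃)) := by
          rw [integral_add cA1.integrable_unitAddTorus cA2.integrable_unitAddTorus]
          exact add_le_add hf₁ ((integral_norm_antidivergence_le hC₁ hg).trans (mul_le_mul_of_nonneg_left hg1 C₁.coe_nonneg))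
  -- assemble
  have hν : 0 ≤ 4 * |ν| := by positivity
  calc _ ≤ _ := step1
    _ ≤ _ := by
        have := mul_le_mul_of_nonneg_left bS (by norm_num : (0:ℝ) ≤ 2)
        have := mul_le_mul_of_nonneg_left bL (by norm_num : (0:ℝ) ≤ 4)
        have := mul_le_mul_of_nonneg_left bD hν
        linarith

end Datum

end JetStep

end Literature.Analysis.FluidPDE
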